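import Summits.CriticalPhenomena.CardyFormulaZ2.Theorems.CardyBoundaryCoulombGasBoundaryDefectGaussianRS17DictionaryOfPart2
import Summits.CriticalPhenomena.CardyFormulaZ2.Theorems.CardyBoundaryCoulombGasBoundaryDefectGaussianRS17RainbowOfConfig
import Summits.CriticalPhenomena.CardyFormulaZ2.Theorems.CardyBoundaryCoulombGasBoundaryDefectGaussianRS17ForcedBits

/-!
# Stub `s17_dictionary_of` of line `rainbow-monomials-in-excursion-kernels` — Part 3:
# the count `‖Zins V ι‖ = #{ω ⊆ E : Rainbow}` from heights-existence and strand-turning invariance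
# (crux `BoundaryDefectGaussianR`, stmt-CriticalPhenomena-14132; insertion dictionary D2, count assembly)

Last of three files: the registered theorem `s17_dictionary_of` of the D2 completion skeleton. For an
ADMISSIBLE leg insertion `ι` on `V` with FLAT insertion points (radius `sinkLegs + 4`) and radius-`3`
CHARTS at the boundary vertices (the remaining geometric hypotheses of the registered signature are
not used), GIVEN heights-existence (H5: on a rainbow configuration every arrow assignment that is
invariant under the turning rule off the cuts and carries the forced bits on the cuts is the arrow
configuration of a valid height configuration) and strand-turning invariance (H6: the turning sum of
a strand from a tracked start to a tracked cut does not depend on the configuration), and a valid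
configuration `h₀`:

  `‖Zins V ι‖ = #{ω ⊆ E : ι.Rainbow V ω}`.

Proof (`s17_dictionary_of`). `Zins = Σ_{ω ⊆ E} A(ω)`, `A(ω) = Σ_h ∏_c turnFactor h (cfgOf ω) c`
(`Z_eq_sum_prod_turnFactor` with Lemma V, Part 46). If `A(ω) ≠ 0` some valid `h` has all its live
turns consistent, so `ω` is rainbow (`tc_rainbow_of_consistent`, Part 38): non-rainbow `ω` do not
contribute (Part 1). For rainbow `ω`, Part 2 gives `A(ω) = ∏_{b tracked cut} exp(i ε(bit h₀ b) (π/12) X b)`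
once every tracked cut `b` is reached through non-cuts from a tracked start with turning sum `X b`:
the start is the other registered end `e_b` with the tag of `b` (`dict_exists_start`: tracked cuts
are ends, Part 38; each tag labels two ends with distinct corners, not both cuts, Parts 22/27; a
non-cut end is a start, Part 27; `Rainbow` joins `e_b` TO `b` since a strand cannot leave a cut), and
`X b` is its turning sum in a fixed reference rainbow configuration — equal to the one in `ω` by H6.
The inputs of Parts 1/2 are Lemma V (`unitDifferences_tracked`), Lemma C (`turnConsistent_frozen_iff`,
Part 19, with `NoPinch` from the charts), the forced bits (`s17_forcedBits`) and H5. Hence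
`Zins = #{rainbow} · Θ` with `‖Θ‖ = 1`.
-/

namespace Summit.CriticalPhenomena.CardyFormulaZ2.Cruxes.BoundaryDefectGaussianR.RainbowMonomialsInExcursionKernels

open Finset Literature.Probability.LatticeModels Literature.Probability.LatticeModels.CollarLegModel
open Literature.Probability.Percolation

section Starts

variable (ι : LegInsertionData) (V : Finset (ℤ × ℤ)) (hadm : ι.IsAdmissible V)
  (hflat : ∀ x ∈ insert ι.sink ι.source, ∃ dvec : ℤ × ℤ,
    (dvec = (1, 0) ∨ dvec = (-1, 0) ∨ dvec = (0, 1) ∨ dvec = (0, -1)) ∧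
    ∀ v : ℤ × ℤ, (v.1 - x.1) ^ 2 + (v.2 - x.2) ^ 2 ≤ ((ι.sinkLegs : ℤ) + 3) ^ 2 →
      (v ∈ V ↔ 0 ≤ (v.1 - x.1) * dvec.1 + (v.2 - x.2) * dvec.2))
  (hchart : ∀ u ∈ V, ∀ k : Fin 4, u + dir k ∉ V → ∃ (K : Fin 4) (c₁ c₂ : ℤ),
    (∀ v : ℤ × ℤ, |v.1 - u.1| ≤ 3 → |v.2 - u.2| ≤ 3 →
      (v ∈ V ↔ c₂ ≤ v.1 * (dir (K + 1)).1 + v.2 * (dir (K + 1)).2)) ∨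
    (∀ v : ℤ × ℤ, |v.1 - u.1| ≤ 3 → |v.2 - u.2| ≤ 3 →
      (v ∈ V ↔ c₁ ≤ v.1 * (dir K).1 + v.2 * (dir K).2 ∧
        c₂ ≤ v.1 * (dir (K + 1)).1 + v.2 * (dir (K + 1)).2)) ∨
    (∀ v : ℤ × ℤ, |v.1 - u.1| ≤ 3 → |v.2 - u.2| ≤ 3 →
      (v ∈ V ↔ c₂ ≤ v.1 * (dir (K + 1)).1 + v.2 * (dir (K + 1)).2 ∨
        v.1 * (dir K).1 + v.2 * (dir K).2 ≤ c₁)))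

include hadm hflat hchart in
/-- **The start of the strand ending at a tracked cut.** For an admissible insertion with flat
insertion points (radius `sinkLegs + 3`) on a charted `V`, every tracked cut corner `b` of the jump
collar has a partner `e`: a tracked corner that follows a cut turn (a start) and is joined TO `b`
through non-cuts in EVERY rainbow configuration — the other registered strand end with the tag of
`b` (tracked cuts are ends; each tag labels two ends with distinct corners, not both cuts; a non-cut
end is a start; a strand cannot leave the cut `b`). [cite: BaxterKellandWu1976, §3–§4] -/
theorem dict_exists_start (b : Site 2 × Fin 4) (hbt : (ι.model V).IsTracked b) (hbc : (ι.model V).IsCut b) :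
    ∃ e : Site 2 × Fin 4, (ι.model V).IsTracked e ∧
      (∃ c₀, (ι.model V).IsCut c₀ ∧ nextCorner ((ι.model V).cfgOf ∅) c₀ = e) ∧
      ∀ ω ⊆ (ι.model V).E, ι.Rainbow V ω → (ι.model V).Joined ω e b := by
  obtain ⟨m, hbm⟩ := tc_trackedCuts_are_ends ι V hadm hflat hchart b hbt hbc
  obtain ⟨hrange, htwo, huniq, -⟩ := s14_strandEnds_tags ι V hadm hflat
  obtain ⟨x, y, hxy, hxy'⟩ := card_eq_two.1 (htwo m (hrange _ hbm).1 (hrange _ hbm).2)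
  -- the other end with the tag `m`
  obtain ⟨e', he'S, hne⟩ : ∃ e' ∈ (ι.strandEnds V).filter (fun e => e.2 = m), e' ≠ (b, m) := by
    by_cases hx : x = (b, m)
    · exact ⟨y, by rw [hxy']; simp, fun h => hxy (hx.trans h.symm)⟩
    · exact ⟨x, by rw [hxy']; simp, hx⟩
  obtain ⟨he', htag⟩ := mem_filter.1 he'S
  have hne1 : e'.1 ≠ b := fun h => hne (huniq e' he' (b, m) hbm h)
  have hncut : ¬(ι.model V).IsCut e'.1 := fun h =>
    s14_strandEnds_types ι V hadm hflat (b, m) hbm e' he' htag.symm hne1.symm ⟨hbc, h⟩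
  refine ⟨e'.1, (s14_strandEnds_pairs ι V hadm hflat e' he').1, s14_strandEnds_start ι V hadm hflat e' he' hncut,
    fun ω _ hrain => ?_⟩
  rcases hrain (b, m) hbm e' he' htag.symm hne1.symm with hj | hj
  · -- a strand cannot leave the cut `b`
    exfalso
    obtain ⟨n, -, hn, hnl⟩ := hj
    rcases Nat.eq_zero_or_pos n with rfl | hpos
    · exact hne1 (by simpa using hn.symm)
    · exact hnl 0 hpos (by simpa using hbc)
  · exact hj

end Starts

/-! ### The registered theorem -/

/-- **W5 main, sub-goal `s17_dictionary_of`** (registered on stmt-CriticalPhenomena-14132; D2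
completion): for an admissible leg insertion `ι` on `V` with flat insertion points and charted
boundary (plus the unused connectivity hypotheses of the eventual regularity package), GIVEN
heights-existence on rainbow configurations (H5) and the configuration-independence of the turning
sums of the strands (H6), and a valid height configuration, the modulus of the insertion partition
function counts the rainbow configurations: `‖Zins V ι‖ = #{ω ⊆ E : ι.Rainbow V ω}`. [cite: BaxterKellandWu1976, §3–§4] -/
theorem s17_dictionary_of : ∀ (ι : Literature.Probability.LatticeModels.CollarLegModel.LegInsertionData) (V : Finset (ℤ × ℤ)) [DecidablePred fun ω : Finset ((ℤ × ℤ) × Bool) => ι.Rainbow V ω], ι.IsAdmissible V → (∀ x ∈ insert ι.sink ι.source, ∃ dvec : ℤ × ℤ, (dvec = (1, 0) ∨ dvec = (-1, 0) ∨ dvec = (0, 1) ∨ dvec = (0, -1)) ∧ ∀ v : ℤ × ℤ, (v.1 - x.1) ^ 2 + (v.2 - x.2) ^ 2 ≤ ((ι.sinkLegs : ℤ) + 4) ^ 2 → (v ∈ V ↔ 0 ≤ (v.1 - x.1) * dvec.1 + (v.2 - x.2) * dvec.2)) → (∀ u ∈ V, ∀ k : Fin 4, u + Literature.Probability.LatticeModels.CollarLegModel.dir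 k ∉ V → ∃ (K : Fin 4) (c₁ c₂ : ℤ), (∀ v : ℤ × ℤ, |v.1 - u.1| ≤ 3 → |v.2 - u.2| ≤ 3 → (v ∈ V ↔ c₂ ≤ v.1 * (Literature.Probability.LatticeModels.CollarLegModel.dir (K + 1)).1 + v.2 * (Literature.Probability.LatticeModels.CollarLegModel.dir (K + 1)).2)) ∨ (∀ v : ℤ × ℤ, |v.1 - u.1| ≤ 3 → |v.2 - u.2| ≤ 3 → (v ∈ V ↔ c₁ ≤ v.1 * (Literature.Probability.LatticeModels.CollarLegModel.dir K).1 + v.2 * (Literature.Probability.LatticeModels.CollarLegModel.dir K).2 ∧ c₂ ≤ v.1 * (Literature.Probability.LatticeModels.CollarLegModel.dir (K + 1)).1 + v.2 * (Literature.Probability.LatticeModels.CollarLegModel.dir (K + 1)).2)) ∨ (∀ v : ℤ × ℤ, |v.1 - u.1| ≤ 3 → |v.2 - u.2| ≤ 3 → (v ∈ V ↔ c₂ ≤ v.1 * (Literature.Probability.LatticeModels.CollarLegModel.dir (K + 1)).1 + v.2 * (Literature.Probability.LatticeModels.CollarLegModel.dir (K + 1)).2 ∨ v.1 * (Literature.Probability.LatticeModels.CollarLegModel.dir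 K).1 + v.2 * (Literature.Probability.LatticeModels.CollarLegModel.dir K).2 ≤ c₁))) → (∀ u ∈ V, ∀ w ∈ V, Relation.ReflTransGen (fun b c : ℤ × ℤ ↦ b ∈ V ∧ c ∈ V ∧ (b.1 - c.1) ^ 2 + (b.2 - c.2) ^ 2 = 1) u w) → (∀ u ∉ V, ∀ w ∉ V, Relation.ReflTransGen (fun b c : ℤ × ℤ ↦ b ∉ V ∧ c ∉ V ∧ max |b.1 - c.1| |b.2 - c.2| ≤ 1) u w) → (∀ z : ℤ × ℤ, z ∉ V → (∃ v ∈ V, max |v.1 - z.1| |v.2 - z.2| ≤ 1) → ∃ σ τ a c : ℤ, |σ| ≤ 1 ∧ |τ| ≤ 1 ∧ ((∀ v : ℤ × ℤ, max |v.1 - z.1| |v.2 - z.2| ≤ 6 → (v ∈ V ↔ 0 ≤ σ * (v.1 - a) ∧ 0 ≤ τ * (v.2 - c))) ∨ (∀ v : ℤ × ℤ, max |v.1 - z.1| |v.2 - z.2| ≤ 6 → (v ∈ V ↔ 0 < σ * (v.1 - a) ∨ 0 < τ * (v.2 - c))))) → (∀ h₀ ∈ (ι.model V).configs, ∀ ω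 ⊆ (ι.model V).E, ι.Rainbow V ω → ∀ (s : Literature.Probability.LatticeModels.Site 2 × Fin 4 → Bool), (∀ c ∈ Literature.Probability.Percolation.cornerSet (ι.model V).piece, ¬(ι.model V).IsCut c → s (Literature.Probability.LatticeModels.nextCorner ((ι.model V).cfgOf ω) c) = s c) → (∀ c ∈ Literature.Probability.Percolation.cornerSet (ι.model V).piece, (ι.model V).IsCut c → s c = (ι.model V).bit h₀ c) → ∃ h ∈ (ι.model V).configs, ∀ c ∈ Literature.Probability.Percolation.cornerSet (ι.model V).piece, (ι.model V).bit h c = s c) → (∀ ω ⊆ (ι.model V).E, ∀ ω' ⊆ (ι.model V).E, ∀ (e b : Literature.Probability.LatticeModels.Site 2 × Fin 4), (ι.model V).IsTracked e → (∃ c₀, (ι.model V).IsCut c₀ ∧ Literature.Probability.LatticeModels.nextCorner ((ι.model V).cfgOf ∅) c₀ = e) → (ι.model V).IsTracked b → (ι.model V).IsCut b → ∀ (n n' : ℕ), (Literature.Probability.LatticeModels.nextCorner ((ι.model V).cfgOf ω))^[n] e = b → (∀ m < n, ¬(ι.model V).IsCut ((Literature.Probability.LatticeModels.nextCorner ((ι.model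 V).cfgOf ω))^[m] e)) → (Literature.Probability.LatticeModels.nextCorner ((ι.model V).cfgOf ω'))^[n'] e = b → (∀ m < n', ¬(ι.model V).IsCut ((Literature.Probability.LatticeModels.nextCorner ((ι.model V).cfgOf ω'))^[m] e)) → ∑ m ∈ Finset.range n, Literature.Probability.LatticeModels.turnSign ((ι.model V).cfgOf ω) ((Literature.Probability.LatticeModels.nextCorner ((ι.model V).cfgOf ω))^[m] e) = ∑ m ∈ Finset.range n', Literature.Probability.LatticeModels.turnSign ((ι.model V).cfgOf ω') ((Literature.Probability.LatticeModels.nextCorner ((ι.model V).cfgOf ω'))^[m] e)) → ((ι.model V).configs).Nonempty → ‖Literature.Probability.LatticeModels.CollarLegModel.Zins V ι‖ = ((((ι.model V).E.powerset.filter (fun ω => ι.Rainbow V ω)).card : ℕ) : ℝ) := by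
  intro ι V _ hadm hflat hchart _ _ _ H5 H6 hne
  classical
  have hflat3 := flat3_of_flat4 ι V hflat
  have hnp := tc_noPinch_of_chart hchart
  have hunitT : ∀ h ∈ (ι.model V).configs, ∀ x ∈ (ι.model V).vertexCells, ∀ f ∈ SixVertex.vertexFaces x,
      f ∈ (ι.model V).faceCells → |(ι.model V).hv h x - (ι.model V).hf h f| = 1 := fun h hh =>
    unitDifferences_tracked V ι hadm hflat (chart8_of_chart3 hchart) h ((mem_configs_iff_isValid _ h).1 hh)
  have hC : ∀ ω ⊆ (ι.model V).E, ∀ h ∈ (ι.model V).configs, ∀ c, ¬(ι.model V).TargetsLive c →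
      ((ι.model V).TurnConsistent h ((ι.model V).cfgOf ω) c ↔
        (ι.model V).TurnConsistent (fun _ => 0) ((ι.model V).cfgOf ∅) c) :=
    fun ω hω h _ c hc => turnConsistent_frozen_iff ι V hadm hnp hω (empty_subset _) h (fun _ => 0) hc
  have hforced := s17_forcedBits ι V hadm hflat hchart
  obtain ⟨h₀, hh₀⟩ := hne
  -- `Zins` as a sum over the bond configurations
  have hZ : Zins V ι = ∑ ω ∈ (ι.model V).E.powerset, ∑ h ∈ (ι.model V).configs,
      ∏ c ∈ cornerSet (ι.model V).piece, (ι.model V).turnFactor h ((ι.model V).cfgOf ω) c :=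
    (ι.model V).Z_eq_sum_prod_turnFactor fun h hh =>
      unitDifferences_live V ι hadm hflat (chart8_of_chart3 hchart) h ((mem_configs_iff_isValid _ h).1 hh)
  -- non-rainbow configurations do not contribute
  have hvan : ∀ ω ⊆ (ι.model V).E, ¬ι.Rainbow V ω →
      ∑ h ∈ (ι.model V).configs, ∏ c ∈ cornerSet (ι.model V).piece, (ι.model V).turnFactor h ((ι.model V).cfgOf ω) c = 0 :=
    fun ω hω hnr => dict_sum_eq_zero_of_inconsistent fun h hh H1 => hnr
      (tc_rainbow_of_consistent ι V hadm hflat3 hchart hω H1 ((mem_configs_iff_isValid _ h).1 hh))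
  -- rainbow configurations all contribute the same unit phase
  obtain ⟨Θ, hΘ1, hΘ⟩ : ∃ Θ : ℂ, ‖Θ‖ = 1 ∧ ∀ ω ⊆ (ι.model V).E, ι.Rainbow V ω →
      ∑ h ∈ (ι.model V).configs, ∏ c ∈ cornerSet (ι.model V).piece, (ι.model V).turnFactor h ((ι.model V).cfgOf ω) c = Θ := by
    by_cases hex : ∃ ωr ⊆ (ι.model V).E, ι.Rainbow V ωr
    · obtain ⟨ωr, hωr, hrr⟩ := hex
      -- the starts of the strands ending at the tracked cuts
      have hS : ∀ b, ∃ e : Site 2 × Fin 4, (ι.model V).IsTracked b → (ι.model V).IsCut b →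
          (ι.model V).IsTracked e ∧ (∃ c₀, (ι.model V).IsCut c₀ ∧ nextCorner ((ι.model V).cfgOf ∅) c₀ = e) ∧
            ∀ ω ⊆ (ι.model V).E, ι.Rainbow V ω → (ι.model V).Joined ω e b := by
        intro b
        by_cases hb : (ι.model V).IsTracked b ∧ (ι.model V).IsCut b
        · obtain ⟨e, he⟩ := dict_exists_start ι V hadm hflat3 hchart b hb.1 hb.2
          exact ⟨e, fun _ _ => he⟩
        · exact ⟨b, fun h1 h2 => absurd ⟨h1, h2⟩ hb⟩
      choose st hst using hS
      -- the turning sums in the reference rainbow configuration `ωr`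
      have hXex : ∀ b, ∃ x : ℤ, (ι.model V).IsTracked b → (ι.model V).IsCut b →
          ∃ n', (nextCorner ((ι.model V).cfgOf ωr))^[n'] (st b) = b ∧
            (∀ m < n', ¬(ι.model V).IsCut ((nextCorner ((ι.model V).cfgOf ωr))^[m] (st b))) ∧
            ∑ m ∈ range n', turnSign ((ι.model V).cfgOf ωr) ((nextCorner ((ι.model V).cfgOf ωr))^[m] (st b)) = x := by
        intro b
        by_cases hb : (ι.model V).IsTracked b ∧ (ι.model V).IsCut b
        · obtain ⟨n', -, hn', hnl'⟩ := (hst b hb.1 hb.2).2.2 ωr hωr hrr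
          exact ⟨_, fun _ _ => ⟨n', hn', hnl', rfl⟩⟩
        · exact ⟨0, fun h1 h2 => absurd ⟨h1, h2⟩ hb⟩
      choose X hX using hXex
      refine ⟨∏ b ∈ (cornerSet (ι.model V).piece).filter (fun c => (ι.model V).IsTracked c ∧ (ι.model V).IsCut c),
        Complex.exp (Complex.I * (BKW.sgn ((ι.model V).bit h₀ b) : ℂ) * ((Real.pi / 12 * (X b : ℝ) : ℝ) : ℂ)),
        ?_, fun ω hω hr => ?_⟩
      · rw [norm_prod]
        refine prod_eq_one fun b _ => ?_
        rw [show Complex.I * (BKW.sgn ((ι.model V).bit h₀ b) : ℂ) * ((Real.pi / 12 * (X b : ℝ) : ℝ) : ℂ) =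
            (((BKW.sgn ((ι.model V).bit h₀ b) : ℝ) * (Real.pi / 12 * (X b : ℝ)) : ℝ) : ℂ) * Complex.I by
          push_cast; ring, Complex.norm_exp_ofReal_mul_I]
      · refine dict_sum_configs_eq_strandPhase hω h₀ hunitT (hC ω hω)
          (fun h hh c hc hcut => hforced h hh h₀ hh₀ c hc hcut) (H5 h₀ hh₀ ω hω hr) X fun b hbt hbc => ?_
        obtain ⟨hte, hstart, hjoin⟩ := hst b hbt hbc
        obtain ⟨n, -, hn, hnl⟩ := hjoin ω hω hr
        obtain ⟨n', hn', hnl', hx⟩ := hX b hbt hbc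
        refine ⟨st b, n, hte, hstart, hn, hnl, ?_⟩
        rw [← hx]
        exact H6 ω hω ωr hωr (st b) b hte hstart hbt hbc n n' hn hnl hn' hnl'
    · exact ⟨1, norm_one, fun ω hω hr => absurd ⟨ω, hω, hr⟩ hex⟩
  -- the count
  have hsum : ∑ ω ∈ (ι.model V).E.powerset, ∑ h ∈ (ι.model V).configs,
      ∏ c ∈ cornerSet (ι.model V).piece, (ι.model V).turnFactor h ((ι.model V).cfgOf ω) c =
      ∑ ω ∈ (ι.model V).E.powerset.filter (fun ω => ι.Rainbow V ω), Θ := by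
    rw [sum_filter]
    refine sum_congr rfl fun ω hω => ?_
    rw [mem_powerset] at hω
    split_ifs with hr
    · exact hΘ ω hω hr
    · exact hvan ω hω hr
  rw [hZ, hsum, sum_const, nsmul_eq_mul, norm_mul, hΘ1, mul_one, Complex.norm_natCast]

end Summit.CriticalPhenomena.CardyFormulaZ2.Cruxes.BoundaryDefectGaussianR.RainbowMonomialsInExcursionKernels
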